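import Literature.Computability.MetaComplexity.HypercubeSchwartzZippel
import Mathlib.Data.Nat.Choose.Bounds
import Mathlib.Algebra.Field.ZMod
import HarnessLib

/-!
# Cell qa-qnc0 — the slack–cost tradeoff for low-degree selections of syndrome representatives

A quantitative form of the mechanism behind planner qa-qnc0-p1's THEOREM N (TARGET §17.6; qa-qnc0-p2
ROUND-2 §4 "Hamming ⊗ repetition") at ARBITRARY lift degree (LIT-MEMO-12 §9).

Setting. Identify the syndrome space of a Hamming-type configuration with `𝔽₂^t` (vectors
`x : Fin t → Bool`); a SELECTION OF REPRESENTATIVES of lift degree `D'` is a family of polynomials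
`f a : {0,1}^t → 𝔽₂` (`a : Fin t → Bool`), each of `𝔽₂`-degree `≤ D'`, such that for every `x`
the selected set `{a : f a x ≠ 0}` XOR-sums to `x` (coordinatewise: `Σ_a f a x · a_i = x_i`). Its
COST is `Σ_a #{x : f a x ≠ 0} = Σ_x #{a : f a x ≠ 0}` (the number of blocks used, summed over `x`;
the coset leader uses one block).

`syndromeSelection_cost`: if the cost is `≤ K · 2^t` then `2^{t−1} ≤ (K·2^{D'} + 1)^{2K}`, i.e.
`K·(D' + log₂(K+1)) ≳ (t−1)/2`: a selection with average cost `K` needs lift degree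
`D' ≳ t/(2K) − log₂ K`, and conversely (not typed) grouping coordinates in blocks of size `D'` costs
`≈ t/D'`. Proof: DLSZ (`two_pow_le_card_support`) prices every active coordinate at `2^{t−D'}`, so
there are `≤ K·2^{D'}` active `a`; Markov leaves `≥ 2^{t−1}` points with `≤ 2K` selected blocks;
`x ↦ {a : f a x ≠ 0}` is injective (it XOR-sums to `x`); and an `N`-set has `≤ (N+1)^m` subsets of
size `≤ m`. Hypothesis-free; no `def`.
-/

namespace Summit.QuantumAdvantage.AdviceFreeQNC0

open Finset Literature.Computability.MetaComplexity Literature.Computability.MetaComplexity.Smolensky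

/-! ### Counting small subsets -/

/-- `Σ_{j ≤ m} N^j ≤ (N+1)^m`. -/
private theorem sum_pow_le_succ_pow (N m : ℕ) : ∑ j ∈ range (m + 1), N ^ j ≤ (N + 1) ^ m := by
  induction m with
  | zero => simp
  | succ m ih =>
    rw [Finset.sum_range_succ, pow_succ]
    calc ∑ j ∈ range (m + 1), N ^ j + N ^ (m + 1) ≤ (N + 1) ^ m + N * (N + 1) ^ m := by
          refine Nat.add_le_add ih ?_
          rw [pow_succ']
          exact Nat.mul_le_mul_left N (Nat.pow_le_pow_left (Nat.le_succ N) m)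
      _ = (N + 1) ^ m * (N + 1) := by ring

/-- **An `N`-set has at most `(N+1)^m` subsets of size `≤ m`.** -/
theorem card_filter_powerset_card_le {α : Type*} [DecidableEq α] (s : Finset α) (m : ℕ) :
    (s.powerset.filter fun S => S.card ≤ m).card ≤ (s.card + 1) ^ m := by
  have hsub : (s.powerset.filter fun S => S.card ≤ m) ⊆
      (range (m + 1)).biUnion fun j => s.powersetCard j := by
    intro S hS
    rw [mem_filter, mem_powerset] at hS
    rw [mem_biUnion]
    exact ⟨S.card, mem_range.2 (Nat.lt_succ_of_le hS.2), mem_powersetCard.2 ⟨hS.1, rfl⟩⟩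
  calc (s.powerset.filter fun S => S.card ≤ m).card
      ≤ ((range (m + 1)).biUnion fun j => s.powersetCard j).card := card_le_card hsub
    _ ≤ ∑ j ∈ range (m + 1), (s.powersetCard j).card := card_biUnion_le
    _ = ∑ j ∈ range (m + 1), s.card.choose j := by simp_rw [card_powersetCard]
    _ ≤ ∑ j ∈ range (m + 1), s.card ^ j := sum_le_sum fun j _ => Nat.choose_le_pow _ _
    _ ≤ (s.card + 1) ^ m := sum_pow_le_succ_pow _ _

/-! ### The tradeoff -/

variable {t : ℕ}

/-- In `ZMod 2`, a value is `0` or `1`. -/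
private theorem zmod2_eq_one_of_ne_zero {x : ZMod 2} (hx : x ≠ 0) : x = 1 := by
  have h : ∀ y : ZMod 2, y ≠ 0 → y = 1 := by decide
  exact h x hx

/-- The selection identity read on the selected set: `Σ_{a : f a x ≠ 0} a_i = x_i`. -/
private theorem sum_filter_indicator_eq (f : (Fin t → Bool) → CubeFn (ZMod 2) t)
    (hsel : ∀ x : Fin t → Bool, ∀ i : Fin t,
      (∑ a : Fin t → Bool, f a x * (if a i = true then (1 : ZMod 2) else 0)) =
        if x i = true then 1 else 0)
    (x : Fin t → Bool) (i : Fin t) :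
    (∑ a ∈ univ.filter (fun a : Fin t → Bool => f a x ≠ 0),
        (if a i = true then (1 : ZMod 2) else 0)) = if x i = true then 1 else 0 := by
  rw [← hsel x i, Finset.sum_filter]
  refine Finset.sum_congr rfl fun a _ => ?_
  by_cases h : f a x ≠ 0
  · rw [if_pos h, zmod2_eq_one_of_ne_zero h, one_mul]
  · rw [if_neg h]
    rw [not_not] at h
    rw [h, zero_mul]

/-- **The slack–cost tradeoff.** If a selection of syndrome representatives of lift degree `D'`
(each `f a` of degree `≤ D'`, selected sets XOR-summing to `x`) has total cost `≤ K·2^t`, then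
`2^{t−1} ≤ (K·2^{D'} + 1)^{2K}`. -/
theorem syndromeSelection_cost {D' K : ℕ} (f : (Fin t → Bool) → CubeFn (ZMod 2) t)
    (hf : ∀ a, f a ∈ lowDeg (ZMod 2) t D')
    (hsel : ∀ x : Fin t → Bool, ∀ i : Fin t,
      (∑ a : Fin t → Bool, f a x * (if a i = true then (1 : ZMod 2) else 0)) =
        if x i = true then 1 else 0)
    (hcost : ∑ a : Fin t → Bool, (univ.filter fun x : Fin t → Bool => f a x ≠ 0).card ≤ K * 2 ^ t) :
    2 ^ (t - 1) ≤ (K * 2 ^ D' + 1) ^ (2 * K) := by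
  classical
  -- the selected set at `x`
  set ρ : (Fin t → Bool) → Finset (Fin t → Bool) := fun x => univ.filter fun a => f a x ≠ 0 with hρ
  -- double counting: total cost = `Σ_x #ρ x`
  have hswap : ∑ a : Fin t → Bool, (univ.filter fun x : Fin t → Bool => f a x ≠ 0).card =
      ∑ x : Fin t → Bool, (ρ x).card := by
    simp only [hρ, Finset.card_filter]
    exact Finset.sum_comm
  -- the active coordinates and their number
  set Act : Finset (Fin t → Bool) := univ.filter fun a => f a ≠ 0 with hAct
  have hρAct : ∀ x, ρ x ⊆ Act := by
    intro x a ha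
    rw [hρ, mem_filter] at ha
    rw [hAct, mem_filter]
    exact ⟨mem_univ _, fun h0 => ha.2 (by rw [h0]; rfl)⟩
  -- DLSZ: each active coordinate costs `2^{t-D'}`, so `#Act ≤ K·2^{D'}`
  have hN : Act.card ≤ K * 2 ^ D' := by
    have h1 : Act.card * 2 ^ (t - D') ≤ K * 2 ^ t := by
      calc Act.card * 2 ^ (t - D') = ∑ a ∈ Act, 2 ^ (t - D') := by rw [sum_const, smul_eq_mul]
        _ ≤ ∑ a ∈ Act, (univ.filter fun x : Fin t → Bool => f a x ≠ 0).card :=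
            sum_le_sum fun a ha => two_pow_le_card_support (hf a) (mem_filter.1 ha).2
        _ ≤ ∑ a : Fin t → Bool, (univ.filter fun x : Fin t → Bool => f a x ≠ 0).card :=
            sum_le_sum_of_subset_of_nonneg (filter_subset _ _) fun _ _ _ => Nat.zero_le _
        _ ≤ K * 2 ^ t := hcost
    have h2 : 2 ^ t ≤ 2 ^ D' * 2 ^ (t - D') := by
      rw [← pow_add]
      exact Nat.pow_le_pow_right (by norm_num) le_add_tsub
    have h3 : Act.card * 2 ^ (t - D') ≤ (K * 2 ^ D') * 2 ^ (t - D') := by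
      calc Act.card * 2 ^ (t - D') ≤ K * 2 ^ t := h1
        _ ≤ K * (2 ^ D' * 2 ^ (t - D')) := Nat.mul_le_mul_left K h2
        _ = (K * 2 ^ D') * 2 ^ (t - D') := by ring
    exact Nat.le_of_mul_le_mul_right h3 (by positivity)
  -- Markov: at least half the points select `≤ 2K` blocks
  set G : Finset (Fin t → Bool) := univ.filter fun x => (ρ x).card ≤ 2 * K with hG
  have hGcard : 2 ^ (t - 1) ≤ G.card := by
    have htot : G.card + (univ.filter fun x : Fin t → Bool => ¬ (ρ x).card ≤ 2 * K).card = 2 ^ t := by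
      rw [hG, Finset.card_filter_add_card_filter_not, card_univ, Fintype.card_fun, Fintype.card_bool,
        Fintype.card_fin]
    have hbad : (2 * K + 1) * (univ.filter fun x : Fin t → Bool => ¬ (ρ x).card ≤ 2 * K).card ≤
        K * 2 ^ t := by
      calc (2 * K + 1) * (univ.filter fun x : Fin t → Bool => ¬ (ρ x).card ≤ 2 * K).card
          = ∑ x ∈ univ.filter (fun x : Fin t → Bool => ¬ (ρ x).card ≤ 2 * K), (2 * K + 1) := by
            rw [sum_const, smul_eq_mul, mul_comm]
        _ ≤ ∑ x ∈ univ.filter (fun x : Fin t → Bool => ¬ (ρ x).card ≤ 2 * K), (ρ x).card :=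
            sum_le_sum fun x hx => by have := (mem_filter.1 hx).2; omega
        _ ≤ ∑ x : Fin t → Bool, (ρ x).card :=
            sum_le_sum_of_subset_of_nonneg (filter_subset _ _) fun _ _ _ => Nat.zero_le _
        _ ≤ K * 2 ^ t := by rw [← hswap]; exact hcost
    rcases Nat.eq_zero_or_pos t with ht | ht
    · subst ht
      -- one point, and it selects nothing costly: `G = univ`
      have : (univ.filter fun x : Fin 0 → Bool => ¬ (ρ x).card ≤ 2 * K).card = 0 := by
        have h := hbad
        simp only [pow_zero, mul_one] at h
        by_contra hne
        have hpos : 1 ≤ (univ.filter fun x : Fin 0 → Bool => ¬ (ρ x).card ≤ 2 * K).card :=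
          Nat.one_le_iff_ne_zero.2 hne
        nlinarith
      simp only [pow_zero] at htot ⊢
      omega
    · have hP : 2 ^ t = 2 * 2 ^ (t - 1) := by
        rw [← pow_succ']; congr 1; omega
      set c := (univ.filter fun x : Fin t → Bool => ¬ (ρ x).card ≤ 2 * K).card with hc
      set Q := 2 ^ (t - 1) with hQ
      by_contra hlt
      push Not at hlt
      have hc1 : Q + 1 ≤ c := by omega
      have := Nat.mul_le_mul_left (2 * K + 1) hc1
      nlinarith
  -- the selection map is injective (its XOR-sum is `x`)
  have hinj : Set.InjOn ρ (G : Set (Fin t → Bool)) := by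
    intro x _ y _ hxy
    funext i
    have hx := sum_filter_indicator_eq f hsel x i
    have hy := sum_filter_indicator_eq f hsel y i
    have hρx : (univ.filter fun a : Fin t → Bool => f a x ≠ 0) = ρ x := rfl
    have hρy : (univ.filter fun a : Fin t → Bool => f a y ≠ 0) = ρ y := rfl
    rw [hρx, hxy, ← hρy, hy] at hx
    -- `hx : [y i] = [x i]` as indicators in `ZMod 2`
    have key : ∀ p q : Bool, ((if p = true then (1 : ZMod 2) else 0) = if q = true then 1 else 0) →
        p = q := by decide
    exact (key _ _ hx).symm
  -- the image of `G` consists of small subsets of `Act`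
  have himg : G.image ρ ⊆ Act.powerset.filter fun S => S.card ≤ 2 * K := by
    intro S hS
    rw [mem_image] at hS
    obtain ⟨x, hx, rfl⟩ := hS
    rw [mem_filter, mem_powerset]
    exact ⟨hρAct x, (mem_filter.1 hx).2⟩
  calc 2 ^ (t - 1) ≤ G.card := hGcard
    _ = (G.image ρ).card := (card_image_of_injOn hinj).symm
    _ ≤ (Act.powerset.filter fun S => S.card ≤ 2 * K).card := card_le_card himg
    _ ≤ (Act.card + 1) ^ (2 * K) := card_filter_powerset_card_le Act (2 * K)
    _ ≤ (K * 2 ^ D' + 1) ^ (2 * K) := Nat.pow_le_pow_left (Nat.succ_le_succ hN) _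

/-! ### The active-coordinate count (REF-ROUND-19 §7 erratum E1; LIT-MEMO-13 §1)

The counting of `syndromeSelection_cost` bites through Markov and the small-subset count; the
following cruder reading is what the LINEAR case needs and is sharp there: the selection map
`x ↦ {a : f a x ≠ 0}` is injective on ALL of `{0,1}^t` (it XOR-sums to `x`) with values in the
subsets of the active set `Act = {a : f a ≠ 0}`, so `2^t ≤ 2^{#Act}`, i.e. `t ≤ #Act`, while DLSZ
prices every active coordinate at `2^{t−D'}`, so `#Act ≤ K·2^{D'}`. Hence `t ≤ K·2^{D'}`; at
`D' = 1` this is `COST ≥ t/2` (the lower-bound half of THEOREM N becomes `(d+2)/2`, `t = d+2`). -/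

/-- **At least `t` coordinates are active, each costing `2^{t−D'}`: `t ≤ K·2^{D'}`.** For every
selection of syndrome representatives of lift degree `D'` (each `f a` of degree `≤ D'`, selected
sets XOR-summing to `x`) with total cost `≤ K·2^t`. -/
theorem syndromeSelection_cost_active {D' K : ℕ} (f : (Fin t → Bool) → CubeFn (ZMod 2) t)
    (hf : ∀ a, f a ∈ lowDeg (ZMod 2) t D')
    (hsel : ∀ x : Fin t → Bool, ∀ i : Fin t,
      (∑ a : Fin t → Bool, f a x * (if a i = true then (1 : ZMod 2) else 0)) =
        if x i = true then 1 else 0)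
    (hcost : ∑ a : Fin t → Bool, (univ.filter fun x : Fin t → Bool => f a x ≠ 0).card ≤ K * 2 ^ t) :
    t ≤ K * 2 ^ D' := by
  classical
  -- the selected set at `x` and the active coordinates
  set ρ : (Fin t → Bool) → Finset (Fin t → Bool) := fun x => univ.filter fun a => f a x ≠ 0 with hρ
  set Act : Finset (Fin t → Bool) := univ.filter fun a => f a ≠ 0 with hAct
  have hρAct : ∀ x, ρ x ⊆ Act := by
    intro x a ha
    rw [hρ, mem_filter] at ha
    rw [hAct, mem_filter]
    exact ⟨mem_univ _, fun h0 => ha.2 (by rw [h0]; rfl)⟩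
  -- DLSZ: each active coordinate costs `2^{t-D'}`, so `#Act ≤ K·2^{D'}`
  have hN : Act.card ≤ K * 2 ^ D' := by
    have h1 : Act.card * 2 ^ (t - D') ≤ K * 2 ^ t := by
      calc Act.card * 2 ^ (t - D') = ∑ a ∈ Act, 2 ^ (t - D') := by rw [sum_const, smul_eq_mul]
        _ ≤ ∑ a ∈ Act, (univ.filter fun x : Fin t → Bool => f a x ≠ 0).card :=
            sum_le_sum fun a ha => two_pow_le_card_support (hf a) (mem_filter.1 ha).2
        _ ≤ ∑ a : Fin t → Bool, (univ.filter fun x : Fin t → Bool => f a x ≠ 0).card :=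
            sum_le_sum_of_subset_of_nonneg (filter_subset _ _) fun _ _ _ => Nat.zero_le _
        _ ≤ K * 2 ^ t := hcost
    have h2 : 2 ^ t ≤ 2 ^ D' * 2 ^ (t - D') := by
      rw [← pow_add]
      exact Nat.pow_le_pow_right (by norm_num) le_add_tsub
    have h3 : Act.card * 2 ^ (t - D') ≤ (K * 2 ^ D') * 2 ^ (t - D') := by
      calc Act.card * 2 ^ (t - D') ≤ K * 2 ^ t := h1
        _ ≤ K * (2 ^ D' * 2 ^ (t - D')) := Nat.mul_le_mul_left K h2
        _ = (K * 2 ^ D') * 2 ^ (t - D') := by ring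
    exact Nat.le_of_mul_le_mul_right h3 (by positivity)
  -- the selection map is injective on the whole cube (its XOR-sum is `x`)
  have hinj : Function.Injective ρ := by
    intro x y hxy
    funext i
    have hx := sum_filter_indicator_eq f hsel x i
    have hy := sum_filter_indicator_eq f hsel y i
    have hρx : (univ.filter fun a : Fin t → Bool => f a x ≠ 0) = ρ x := rfl
    have hρy : (univ.filter fun a : Fin t → Bool => f a y ≠ 0) = ρ y := rfl
    rw [hρx, hxy, ← hρy, hy] at hx
    have key : ∀ p q : Bool, ((if p = true then (1 : ZMod 2) else 0) = if q = true then 1 else 0) →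
        p = q := by decide
    exact (key _ _ hx).symm
  -- its image consists of subsets of `Act`: `2^t ≤ 2^{#Act}`
  have himg : (univ : Finset (Fin t → Bool)).image ρ ⊆ Act.powerset := by
    intro S hS
    rw [mem_image] at hS
    obtain ⟨x, _, rfl⟩ := hS
    exact mem_powerset.2 (hρAct x)
  have h2t : 2 ^ t ≤ 2 ^ Act.card := by
    calc 2 ^ t = (univ : Finset (Fin t → Bool)).card := by
          rw [card_univ, Fintype.card_fun, Fintype.card_bool, Fintype.card_fin]
      _ = ((univ : Finset (Fin t → Bool)).image ρ).card := (card_image_of_injective _ hinj).symm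
      _ ≤ Act.powerset.card := card_le_card himg
      _ = 2 ^ Act.card := card_powerset Act
  have ht : t ≤ Act.card := (Nat.pow_le_pow_iff_right (by norm_num)).1 h2t
  exact ht.trans hN

/-- **The linear case `D' = 1`: `COST ≥ t/2`.** A selection of syndrome representatives by
polynomials of degree `≤ 1` with total cost `≤ K·2^t` has `t ≤ 2K` (REF-ROUND-19 §7 E1: the
corrected and strengthened reading (a) of LIT-MEMO-12 §9 — for the Hamming-type families,
`t = d + 2`, the lower-bound half of THEOREM N improves from `(d+3)/4` to `(d+2)/2`). -/
theorem syndromeSelection_cost_affine {K : ℕ} (f : (Fin t → Bool) → CubeFn (ZMod 2) t)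
    (hf : ∀ a, f a ∈ lowDeg (ZMod 2) t 1)
    (hsel : ∀ x : Fin t → Bool, ∀ i : Fin t,
      (∑ a : Fin t → Bool, f a x * (if a i = true then (1 : ZMod 2) else 0)) =
        if x i = true then 1 else 0)
    (hcost : ∑ a : Fin t → Bool, (univ.filter fun x : Fin t → Bool => f a x ≠ 0).card ≤ K * 2 ^ t) :
    t ≤ 2 * K := by
  have h := syndromeSelection_cost_active f hf hsel hcost
  rw [pow_one, mul_comm] at h
  exact h

end Summit.QuantumAdvantage.AdviceFreeQNC0
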